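import Summits.ValiantsHypothesis.ValiantsHypothesis.Theorems.BarrierLeverAnchoredDoorHitsLowerPairsStarFacePivot
import Summits.ValiantsHypothesis.ValiantsHypothesis.Theorems.BarrierLeverAnchoredDoorHitsLowerPairsStarArrow

/-!
# Route BarrierLever — support item `AnchoredDoorHitsLowerPairs` (stmt-ValiantsHypothesis-22510), line `anchored_peeling`:
# THE STAR LABELLING PRINCIPLE — a parameter-free combinatorial certificate for the star-forest matrix (val-np-p1 g33)

A CLOSURE DEVICE for the door slot of record `Stmt.conjStarLower` / the theory target `Stmt.conjStarTN` (…StarDoor) that needs NO numeric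
witness and NO balance condition: a LABELLING of the vertices decides, by the determinant of an explicit matrix of natural numbers, that
some complex weights make the star-forest block nonsingular.

THE DEVICE (`starDet_ne_zero_of_labelling`). Give every row vertex `b` a finite set `W b` of column vertices and every column vertex `e`
a finite set `B e` of row vertices (its LABEL; `∅` = unlabelled). On the ONE-PARAMETER FAMILY
  `g b e = [b ∈ B e] · X ^ (1 + |W b|)`,   `d b e = [e ∈ W b] · X ^ (1 + |B e|)`
(a vertex may hang as a leaf only from a centre whose label contains it, and a labelled leaf carries the extra weight of its own label)
every star-forest entry `starEntry g d A S` is a polynomial in `X` of degree at most the POTENTIAL `pot A S = Σ_{b ∈ A} |W b| + Σ_{e ∈ S} |B e|`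
(`natDegree_starEntry_lab_le`: each leaf of a centre `v` lies in the label of `v`, so the number of leaves is at most the total label size
of the centres), and its `X^{pot A S}`-coefficient is the natural number `labTop W B A S` (`coeff_starEntry_lab`) — combinatorially, the number
of ways of writing `A ⊔ S` as a disjoint union of FULL STARS `{v} ⊔ label(v)` of labelled vertices together with isolated unlabelled vertices
(the top power forces every labelled centre to carry exactly its label and every leaf to sit in exactly one chosen label). The potential is
ADDITIVE in (row, column), so the `X^{Σ pot}`-coefficient of the determinant of the block is the determinant of the matrix `labTop` (Literature
`coeff_det_of_natDegree_le` after rescaling rows and columns by powers of `X`); if that integer determinant is nonzero, the determinant is a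
nonzero polynomial and some complex value of `X` is good. NO lower-set or injectivity hypothesis is used (so this is also a device for TN-STAR).

MECHANISM (why these exponents): the torus scaling `x_b ↦ t^{-|W b|} x_b`, `y_e ↦ t^{-|B e|} y_e` of the zeon tensor
`∏_b (1 + x_b ⊗ (e^{m_b} − 1)) ∏_e (1 + (e^{ℓ_e} − 1) ⊗ y_e)` sends it, as `t → ∞`, to the purely combinatorial tensor
`∏_b (1 + x_b ⊗ y^{W b}) ∏_e (1 + x^{B e} ⊗ y_e)`; `labTop` is its coefficient matrix (in the isolated-centres-allowed normalisation of `starEntry`).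

USE. At the door level (`symbolicDet_two_ne_zero_of_labelling`, `anchoredHit_two_of_labelling`, via …StarArrow) every injective lower pair
with a nonsingular labelling matrix is hit by 𝔄₂. The parity pair `(K_{1,4}, C₄ ⊔ pt)` — on which BOTH evaluation doors are singular — has the
labelling `B p = {c}`, `B y_i = {c, l_i}`, `W l_i = {y_i, y_{i+1}}` whose `labTop` matrix is a PERMUTATION matrix (HOME/val-np-p1/g33 memo §2);
all 40 ordered lower pairs on `4+4` vertices have a nonsingular labelling (lab/mono_search.py). The device is NOT universal: no labelling (even
with the wider menu of tie labels) was found for the evaluation-good pair `(2^{[4]}, B(5,2))` (best rank 15/16), so it complements, and does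
not replace, the evaluation-type certificates (…StarFaces, …StarCofactor). It does NOT prove `Stmt.conjStarLower`; nothing here bears on crux
14610 or on `VP ≠ VNP`.
-/

set_option linter.dupNamespace false

namespace Summit.ValiantsHypothesis.ValiantsHypothesis.Theorems.BarrierLever.AnchoredPeeling

open Finset Polynomial

noncomputable section

namespace StarDoor

variable {h : ℕ}

/-! ## 1. Labels, the one-parameter family, potentials and the top matrix -/

section Defs

variable (W B : Fin h → Finset (Fin h))

/-- Row-leaf weights of the labelling family: `b` hangs from the column centre `e` only if `b ∈ B e`, with weight `X ^ (1 + |W b|)`. -/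
def gLab (b e : Fin h) : ℂ[X] := if b ∈ B e then X ^ (1 + (W b).card) else 0

/-- Column-leaf weights of the labelling family: `e` hangs from the row centre `b` only if `e ∈ W b`, with weight `X ^ (1 + |B e|)`. -/
def dLab (b e : Fin h) : ℂ[X] := if e ∈ W b then X ^ (1 + (B e).card) else 0

/-- The POTENTIAL of a (row set, column set): total label size. It is additive in the two arguments. -/
def pot (A S : Finset (Fin h)) : ℕ := ∑ b ∈ A, (W b).card + ∑ e ∈ S, (B e).card

/-- Degree in `X` of the `(A', S')`-summand of `starEntry` on the family (`A'` = row centres, `S'` = column centres). -/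
def labDeg (A S A' S' : Finset (Fin h)) : ℕ := ∑ b ∈ A \ A', (1 + (W b).card) + ∑ e ∈ S \ S', (1 + (B e).card)

/-- Coefficient of the `(A', S')`-summand: the number of ways of hanging every row leaf `b ∈ A ∖ A'` from a column centre `e ∈ S'` with
`b ∈ B e` and every column leaf `e ∈ S ∖ S'` from a row centre `b ∈ A'` with `e ∈ W b`. -/
def labCount (A S A' S' : Finset (Fin h)) : ℕ :=
  (∏ b ∈ A \ A', (S'.filter (fun e => b ∈ B e)).card) * ∏ e ∈ S \ S', (A'.filter (fun b => e ∈ W b)).card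

/-- **The labelling matrix entry** `labTop W B A S`: the `X^{pot A S}`-coefficient of `starEntry` on the family (`coeff_starEntry_lab`), i.e. the
total count of the summands of top degree. Combinatorially: the number of pairs (`A'` ⊆ `A`, `S'` ⊆ `S`) such that the labels of the labelled
centres in `S'` partition `A ∖ A'`, the labels of the labelled centres in `A'` partition `S ∖ S'`, and the unlabelled centres are isolated. -/
def labTop (A S : Finset (Fin h)) : ℕ :=
  ∑ A' ∈ A.powerset, ∑ S' ∈ S.powerset, if labDeg W B A S A' S' = pot W B A S then labCount W B A S A' S' else 0

end Defs

/-! ## 2. The summands of `starEntry` on the family are monomials -/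

section Entry

variable (W B : Fin h → Finset (Fin h))

/-- A row leaf `b` against the column centres `S'`: `Σ_{e ∈ S'} g b e = #{e ∈ S' : b ∈ B e} · X^{1 + |W b|}`. -/
theorem sum_gLab (b : Fin h) (S' : Finset (Fin h)) :
    ∑ e ∈ S', gLab W B b e = ((S'.filter (fun e => b ∈ B e)).card : ℂ[X]) * X ^ (1 + (W b).card) := by
  classical
  unfold gLab
  rw [← Finset.sum_filter, Finset.sum_const, nsmul_eq_mul]

/-- A column leaf `e` against the row centres `A'`: `Σ_{b ∈ A'} d b e = #{b ∈ A' : e ∈ W b} · X^{1 + |B e|}`. -/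
theorem sum_dLab (e : Fin h) (A' : Finset (Fin h)) :
    ∑ b ∈ A', dLab W B b e = ((A'.filter (fun b => e ∈ W b)).card : ℂ[X]) * X ^ (1 + (B e).card) := by
  classical
  unfold dLab
  rw [← Finset.sum_filter, Finset.sum_const, nsmul_eq_mul]

/-- A product of monomials `(n_i · X^{k_i})` is the monomial `(∏ n_i) · X^{Σ k_i}`. -/
theorem prod_natCast_mul_X_pow {ι : Type*} (s : Finset ι) (n : ι → ℕ) (k : ι → ℕ) :
    ∏ i ∈ s, ((n i : ℂ[X]) * X ^ (k i)) = ((∏ i ∈ s, n i : ℕ) : ℂ[X]) * X ^ (∑ i ∈ s, k i) := by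
  rw [Finset.prod_mul_distrib, Finset.prod_pow_eq_pow_sum, Nat.cast_prod]

/-- **The `(A', S')`-summand is the monomial `labCount · X^{labDeg}`.** -/
theorem starTerm_lab (A S A' S' : Finset (Fin h)) :
    (∏ b ∈ A \ A', ∑ e ∈ S', gLab W B b e) * (∏ e ∈ S \ S', ∑ b ∈ A', dLab W B b e)
      = ((labCount W B A S A' S' : ℕ) : ℂ[X]) * X ^ (labDeg W B A S A' S') := by
  simp_rw [sum_gLab, sum_dLab]
  rw [prod_natCast_mul_X_pow, prod_natCast_mul_X_pow]
  unfold labCount labDeg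
  rw [Nat.cast_mul, pow_add]
  ring

/-- **`starEntry` on the family is the sum of these monomials.** -/
theorem starEntry_lab_eq (A S : Finset (Fin h)) :
    starEntry (gLab W B) (dLab W B) A S
      = ∑ A' ∈ A.powerset, ∑ S' ∈ S.powerset, ((labCount W B A S A' S' : ℕ) : ℂ[X]) * X ^ (labDeg W B A S A' S') := by
  unfold starEntry
  exact Finset.sum_congr rfl fun A' _ => Finset.sum_congr rfl fun S' _ => starTerm_lab W B A S A' S'

end Entry

/-! ## 3. Degree bound and top coefficient -/

section Degree

variable (W B : Fin h → Finset (Fin h))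

/-- Double counting: if every `b ∈ D` lies in the label of some `e ∈ S'`, then `|D| ≤ Σ_{e ∈ S'} |B e|`. -/
theorem card_le_sum_card_of_covered (D S' : Finset (Fin h)) (hcov : ∀ b ∈ D, (S'.filter (fun e => b ∈ B e)).card ≠ 0) :
    D.card ≤ ∑ e ∈ S', (B e).card := by
  classical
  calc D.card = ∑ b ∈ D, 1 := by simp
    _ ≤ ∑ b ∈ D, (S'.filter (fun e => b ∈ B e)).card :=
        Finset.sum_le_sum fun b hb => Nat.one_le_iff_ne_zero.mpr (hcov b hb)
    _ = ∑ b ∈ D, ∑ e ∈ S', (if b ∈ B e then 1 else 0) := by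
        refine Finset.sum_congr rfl fun b _ => ?_
        rw [Finset.card_filter]
    _ = ∑ e ∈ S', ∑ b ∈ D, (if b ∈ B e then 1 else 0) := Finset.sum_comm
    _ = ∑ e ∈ S', (D.filter (fun b => b ∈ B e)).card := by
        refine Finset.sum_congr rfl fun e _ => ?_
        rw [Finset.card_filter]
    _ ≤ ∑ e ∈ S', (B e).card := by
        refine Finset.sum_le_sum fun e _ => Finset.card_le_card ?_
        intro b hb
        exact (Finset.mem_filter.mp hb).2

/-- **Degree bound for a summand:** a summand with nonzero coefficient has degree at most the potential (each leaf sits in the label of its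
centre, so the number of row leaves is at most the total label size of the column centres, and symmetrically). -/
theorem labDeg_le_pot {A S A' S' : Finset (Fin h)} (hA' : A' ⊆ A) (hS' : S' ⊆ S) (hc : labCount W B A S A' S' ≠ 0) :
    labDeg W B A S A' S' ≤ pot W B A S := by
  classical
  unfold labCount at hc
  have hc1 : ∀ b ∈ A \ A', (S'.filter (fun e => b ∈ B e)).card ≠ 0 := by
    intro b hb h0
    exact hc (by rw [Finset.prod_eq_zero hb h0, zero_mul])
  have hc2 : ∀ e ∈ S \ S', (A'.filter (fun b => e ∈ W b)).card ≠ 0 := by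
    intro e he h0
    exact hc (by rw [Finset.prod_eq_zero he h0, mul_zero])
  have h1 : (A \ A').card ≤ ∑ e ∈ S', (B e).card := card_le_sum_card_of_covered B (A \ A') S' hc1
  have h2 : (S \ S').card ≤ ∑ b ∈ A', (W b).card := card_le_sum_card_of_covered W (S \ S') A' hc2
  have hsplitA : ∑ b ∈ A, (W b).card = ∑ b ∈ A \ A', (W b).card + ∑ b ∈ A', (W b).card := (Finset.sum_sdiff hA').symm
  have hsplitS : ∑ e ∈ S, (B e).card = ∑ e ∈ S \ S', (B e).card + ∑ e ∈ S', (B e).card := (Finset.sum_sdiff hS').symm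
  unfold labDeg pot
  rw [Finset.sum_add_distrib, Finset.sum_add_distrib, Finset.sum_const, Finset.sum_const, smul_eq_mul, smul_eq_mul, mul_one, mul_one,
    hsplitA, hsplitS]
  omega

/-- **Degree bound:** `starEntry` on the family has degree at most the potential. -/
theorem natDegree_starEntry_lab_le (A S : Finset (Fin h)) :
    (starEntry (gLab W B) (dLab W B) A S).natDegree ≤ pot W B A S := by
  classical
  rw [starEntry_lab_eq]
  refine natDegree_sum_le_of_forall_le _ _ fun A' hA' => natDegree_sum_le_of_forall_le _ _ fun S' hS' => ?_
  by_cases hc : labCount W B A S A' S' = 0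
  · rw [hc, Nat.cast_zero, zero_mul, natDegree_zero]; exact Nat.zero_le _
  · refine le_trans ?_ (labDeg_le_pot W B (Finset.mem_powerset.mp hA') (Finset.mem_powerset.mp hS') hc)
    rw [← map_natCast C]
    exact natDegree_C_mul_X_pow_le _ _

/-- **Top coefficient:** the `X^{pot A S}`-coefficient of `starEntry` on the family is `labTop W B A S`. -/
theorem coeff_starEntry_lab (A S : Finset (Fin h)) :
    (starEntry (gLab W B) (dLab W B) A S).coeff (pot W B A S) = (labTop W B A S : ℂ) := by
  classical
  rw [starEntry_lab_eq, finsetSum_coeff]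
  unfold labTop
  rw [Nat.cast_sum]
  refine Finset.sum_congr rfl fun A' _ => ?_
  rw [finsetSum_coeff, Nat.cast_sum]
  refine Finset.sum_congr rfl fun S' _ => ?_
  rw [← map_natCast C, coeff_C_mul_X_pow, Nat.cast_ite, Nat.cast_zero]
  by_cases hdeg : labDeg W B A S A' S' = pot W B A S
  · rw [if_pos hdeg.symm, if_pos hdeg]
  · rw [if_neg (fun h' => hdeg h'.symm), if_neg hdeg]

end Degree

/-! ## 4. The labelling principle -/

section Principle

variable {r : ℕ} (u w : Fin r → Finset (Fin h)) (W B : Fin h → Finset (Fin h))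

/-- **THE STAR LABELLING PRINCIPLE.** For ANY row and column families `u w` (no lower-set, no injectivity hypothesis) and ANY labels
`W` (row vertices ↦ sets of column vertices), `B` (column vertices ↦ sets of row vertices): if the natural-number matrix
`(labTop W B (u i) (w j))_{i j}` is nonsingular, then some complex weights make the star-forest block `(starEntry g d (u i) (w j))` nonsingular. -/
theorem starDet_ne_zero_of_labelling
    (hN : (Matrix.of fun i j : Fin r => (labTop W B (u i) (w j) : ℂ)).det ≠ 0) :
    ∃ g d : Fin h → Fin h → ℂ, (Matrix.of fun i j : Fin r => starEntry g d (u i) (w j)).det ≠ 0 := by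
  classical
  -- the block on the family, and its rescaling to uniform degree
  let a : Fin r → ℕ := fun i => ∑ b ∈ u i, (W b).card
  let c : Fin r → ℕ := fun j => ∑ e ∈ w j, (B e).card
  let Ka : ℕ := ∑ i, a i
  let Kc : ℕ := ∑ j, c j
  have ha : ∀ i, a i ≤ Ka := fun i => Finset.single_le_sum (f := a) (fun i _ => Nat.zero_le _) (Finset.mem_univ i)
  have hc : ∀ j, c j ≤ Kc := fun j => Finset.single_le_sum (f := c) (fun j _ => Nat.zero_le _) (Finset.mem_univ j)
  have hpot : ∀ i j, pot W B (u i) (w j) = a i + c j := fun i j => rfl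
  let MP : Matrix (Fin r) (Fin r) ℂ[X] := Matrix.of fun i j => starEntry (gLab W B) (dLab W B) (u i) (w j)
  let MS : Matrix (Fin r) (Fin r) ℂ[X] := Matrix.of fun i j => X ^ (Ka - a i) * MP i j * X ^ (Kc - c j)
  have hdeg : ∀ i j, (MS i j).natDegree ≤ Ka + Kc := by
    intro i j
    simp only [MS, MP, Matrix.of_apply]
    have h1 : (starEntry (gLab W B) (dLab W B) (u i) (w j)).natDegree ≤ a i + c j := by
      rw [← hpot]; exact natDegree_starEntry_lab_le W B (u i) (w j)
    calc (X ^ (Ka - a i) * starEntry (gLab W B) (dLab W B) (u i) (w j) * X ^ (Kc - c j)).natDegree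
        ≤ (X ^ (Ka - a i) * starEntry (gLab W B) (dLab W B) (u i) (w j)).natDegree + (X ^ (Kc - c j) : ℂ[X]).natDegree :=
          natDegree_mul_le
      _ ≤ ((X ^ (Ka - a i) : ℂ[X]).natDegree + (starEntry (gLab W B) (dLab W B) (u i) (w j)).natDegree) + (X ^ (Kc - c j) : ℂ[X]).natDegree :=
          Nat.add_le_add_right natDegree_mul_le _
      _ ≤ ((Ka - a i) + (a i + c j)) + (Kc - c j) := by
          gcongr
          · exact natDegree_X_pow_le _
          · exact natDegree_X_pow_le _
      _ = Ka + Kc := by have := ha i; have := hc j; omega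
  have hcoefMS : (MS.map fun p => p.coeff (Ka + Kc)) = Matrix.of fun i j : Fin r => (labTop W B (u i) (w j) : ℂ) := by
    ext i j
    simp only [MS, MP, Matrix.map_apply, Matrix.of_apply]
    have hK : Ka + Kc = ((a i + c j) + (Ka - a i)) + (Kc - c j) := by have := ha i; have := hc j; omega
    rw [hK, coeff_mul_X_pow, coeff_X_pow_mul, ← hpot, coeff_starEntry_lab]
  -- the top coefficient of `det MS` is `det labTop ≠ 0`
  have hcoef : (MS.det).coeff (Fintype.card (Fin r) * (Ka + Kc)) = (Matrix.of fun i j : Fin r => (labTop W B (u i) (w j) : ℂ)).det := by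
    rw [Literature.AlgebraicGeometry.DeterminantalHypersurfaces.coeff_det_of_natDegree_le MS (Ka + Kc) hdeg, hcoefMS]
  have hMS : MS.det ≠ 0 := by
    intro h0
    apply hN
    rw [← hcoef, h0, coeff_zero]
  have hMSeq : MS = Matrix.diagonal (fun i => (X : ℂ[X]) ^ (Ka - a i)) * MP * Matrix.diagonal (fun j => (X : ℂ[X]) ^ (Kc - c j)) := by
    ext i j
    simp only [MS, Matrix.of_apply, Matrix.mul_diagonal, Matrix.diagonal_mul]
  have hMP : MP.det ≠ 0 := by
    intro h0
    apply hMS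
    rw [hMSeq, Matrix.det_mul, Matrix.det_mul, h0, mul_zero, zero_mul]
  -- a nonzero complex polynomial has a non-root
  have hex : ∃ t : ℂ, ¬ (MP.det).IsRoot t := by
    by_contra hall
    push Not at hall
    apply hMP
    apply Polynomial.eq_zero_of_infinite_isRoot
    have huniv : {x : ℂ | (MP.det).IsRoot x} = Set.univ := Set.eq_univ_of_forall fun x => hall x
    rw [huniv]
    exact Set.infinite_univ
  obtain ⟨t, ht⟩ := hex
  refine ⟨fun b e => Polynomial.eval t (gLab W B b e), fun b e => Polynomial.eval t (dLab W B b e), ?_⟩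
  have hev : Polynomial.eval t MP.det =
      (Matrix.of fun i j : Fin r => starEntry (fun b e => Polynomial.eval t (gLab W B b e))
        (fun b e => Polynomial.eval t (dLab W B b e)) (u i) (w j)).det := by
    rw [← Polynomial.coe_evalRingHom, RingHom.map_det, RingHom.mapMatrix_apply]
    congr 1; ext i j; simp only [MP, Matrix.map_apply, Matrix.of_apply]; rw [map_starEntry]
  rw [← hev]
  exact ht

/-- **The labelling principle at the door level:** an injective lower pair with a nonsingular labelling matrix has `symbolicDet 2 ≠ 0`. -/
theorem symbolicDet_two_ne_zero_of_labelling (hu : Function.Injective u) (hw : Function.Injective w)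
    (hlu : IsLowerSet (Set.range u)) (hlw : IsLowerSet (Set.range w))
    (hN : (Matrix.of fun i j : Fin r => (labTop W B (u i) (w j) : ℂ)).det ≠ 0) :
    symbolicDet 2 h r u w ≠ 0 := by
  obtain ⟨g, d, hdet⟩ := starDet_ne_zero_of_labelling u w W B hN
  exact symbolicDet_two_ne_zero_of_starDet g d u w hu hw hlu hlw hdet

/-- **… as an anchored hit at profile 2.** -/
theorem anchoredHit_two_of_labelling (hu : Function.Injective u) (hw : Function.Injective w)
    (hlu : IsLowerSet (Set.range u)) (hlw : IsLowerSet (Set.range w))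
    (hN : (Matrix.of fun i j : Fin r => (labTop W B (u i) (w j) : ℂ)).det ≠ 0) :
    AnchoredHit 2 h r u w :=
  stub_genericPoint 2 h r u w (symbolicDet_two_ne_zero_of_labelling u w W B hu hw hlu hlw hN)

end Principle

end StarDoor

end

end Summit.ValiantsHypothesis.ValiantsHypothesis.Theorems.BarrierLever.AnchoredPeeling
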